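import Literature.NumberTheory.Automorphic.FontaineMazurGL2OddPrimeTateTwist
import Literature.NumberTheory.Automorphic.SerreConjecture
import HarnessLib

/-!
# Fontaine–Mazur for `GL₂/ℚ` at `p = 2` with non-solvable residual image (Tung 2020, Thm. 1)

Topic `Literature/NumberTheory/Automorphic`; the dyadic companion of `FontaineMazurGL2OddPrime`
(`Tung2021_fontaineMazurGL2`, `XZhang2024_fontaineMazurGL2_oddPrime`: every ODD prime) and of
`FontaineMazurGL2OddPrimeTateTwist` (`XZhang2024_fontaineMazurGL2_tateTwist`, the rendering with a
TATE twist), whose module docstrings list "`p = 2` (Tung, Math. Z. 298 [Tung2020])" under "What is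
NOT here".  ONE named fact (D-0014), `Tung2020_fontaineMazurGL2_two_tateTwist`, in exactly the
vocabulary and the Tate-twist rendering of `XZhang2024_fontaineMazurGL2_tateTwist`, with the two
extra hypotheses the dyadic theorem carries: the residual representation has NON-SOLVABLE image,
and it is MODULAR (rendered in Serre's shape, so that the in-tree Khare–Wintenberger fact
`khare_wintenberger 2 k` discharges it — as the source itself remarks).

## The printed theorem (S.-N. Tung, *On the modularity of 2-adic potentially semi-stable
## deformation rings*, Math. Z. 298 (2021) 107–159 = arXiv:1908.06174 [Tung2020]; read in the held
## TeX text of arXiv:1908.06174, whose numbering is used)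

* Introduction, standing hypotheses (Conjecture (Fontaine–Mazur)): "Let `ρ : Gal(ℚ̄/ℚ) → GL₂(𝒪)`
  be a continuous, irreducible representation such that • `ρ` is odd; • `ρ` is unramified outside
  all but finitely many places; • the restriction of `ρ` at the decomposition group at `p` is de
  Rham with distinct Hodge–Tate weights. Then (up to a twist) `ρ ≅ ρ_f` for some cuspidal eigenform
  `f`."  (`𝒪` = "the ring of integers of a sufficiently large finite extension over `ℚ_p`".)
* Introduction, definitions: "We will say that `ρ` is modular if it is isomorphic to a twist of
  `ρ_f` by a character. Similarly, we will say that `ρ̄ : Gal(ℚ̄/ℚ) → GL₂(k)` is modular if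
  `ρ̄ ≅ ρ̄_f` up to a twist, where `k` is the residue field of `𝒪` and `ρ̄_f` is obtained by reducing
  the matrix entries of `ρ_f` modulo the maximal ideal of `𝒪`."
* **Theorem 1** (Introduction): "Assume `p = 2`. Let `ρ` be as in the conjecture. Let
  `ρ̄ : Gal(ℚ̄/ℚ) → GL₂(k)` be the reduction of `ρ` modulo the maximal ideal of `𝒪`. Assume
  furthermore that • `ρ|_{Gal(ℚ̄_p/ℚ_p)}` has distinct Hodge–Tate weights. • `ρ̄` is modular. • `ρ̄`
  has non-solvable image. Then `ρ` is modular."  Followed by: "We note that since we work over `ℚ`,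
  the condition on the modularity of `ρ̄` follows from a deep theorem of Khare–Wintenberger
  [KhareWintenberger2009] and Kisin [Kisin2009TwoAdic]."  And: "Indeed we prove the theorem in a
  more general context, i.e. `F` is a totally real field in which `p` splits completely … (see
  Theorem 8.0.4 for the precise statement)."
* **Theorem 8.0.4** (§8 Main results): "Let `F` be a totally real field in which `p` splits
  completely. Let `ρ : G_F → GL₂(𝒪)` be a continuous representation. Suppose that (1) `ρ` is
  ramified at only finitely many places; (2) `ρ̄` is modular; (3) `ρ̄` is totally odd; (4) `ρ̄` has
  non-solvable image; (5) for every `v | p`, `ρ|_{F_v}` is potentially semi-stable with distinct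
  Hodge–Tate weights. Then (up to twist) `ρ` comes from a Hilbert modular form."  Its proof ends:
  "we see that `ρ|_{G_{F'}}` is automorphic and this proves the theorem" (`F'/F` a suitable solvable
  totally real extension; "automorphic" = Definition 2.0.7: "`ρ ≅ ρ_{π,ι}`" for "a regular algebraic
  cuspidal automorphic representation `π` of `GL₂(𝔸_F)`", `ρ_{π,ι}` normalised by Theorem 2.0.6).

## Rendering in the tree's vocabulary (read before reviewing) — verbatim the clauses of
## `XZhang2024_fontaineMazurGL2_tateTwist` at the prime `2`, plus clauses (NS) and (RM)

* `ρ : Gal(ℚ̄/ℚ) → GL₂(𝒪)` continuous, `𝒪 ⊂ E` finite over `ℚ₂`: a continuous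
  `ρ : Γ_ℚ → GL₂(ℚ̄₂)` (`FramedGaloisRep ℚ (PadicAlgCl 2) 2`) unramified at all but finitely many
  places (such a `ρ` has a model over a finite `E/ℚ₂` stabilising an `𝒪_E`-lattice — the accepted,
  proved `exists_hasQlModel_holds` — so this is the printed setting); "irreducible", "odd":
  `ρ.toGaloisRep.IsIrreducible`, `ρ.IsOdd` (`det ρ(c) = -1`, kept in characteristic `0`, where it
  is a genuine condition; residually it is vacuous at `2`).
* "de Rham at `p` with distinct Hodge–Tate weights": de Rham for Fontaine's PINNED datum
  (`(fontainePstAdicCompletion v 2 hv).IsDeRhamFramed (ρ.toLocal v)`) with multiplicity-free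
  labelled Hodge–Tate weights — VERBATIM the clause of `XZhang2024_fontaineMazurGL2_tateTwist` and of
  the route statements of `Langlands/DyadicOddResidue` (there `ℓ = 2` after `ℓ = 2 → …`).
* **(NS) "`ρ̄` has non-solvable image"**: `¬ IsSolvable ρ.residualRep.range`, where
  `ρ.residualRep : Γ_ℚ → GL₂(ℤ̄₂/𝔪)` is the tree's CHOSEN residual representation (the
  semisimplification of the reduction of an integral model over `ℤ̄₂ = padicAlgClIntegers 2`,
  accepted `ResidualGaloisRep`; well defined up to conjugacy by Brauer–Nesbitt).  Faithful: a
  reduction with non-solvable image is irreducible, hence is its own semisimplification, and two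
  lattices (Tung's `𝒪`-lattice, the tree's `ℤ̄₂`-lattice) have reductions with the same
  semisimplification; conversely a non-solvable semisimplification forces the reduction to be
  irreducible.  The junk value `residualRep = 1` (no semisimplified reduction — never the case) has
  solvable range, so (NS) can only hold for a genuine residual representation.  VERBATIM the
  hypothesis of the route decl `DyadicOddResidue.DyadicNonsolvableFM`.
* **(RM) "`ρ̄` is modular"** (`ρ̄ ≅ ρ̄_f` up to a twist): rendered in SERRE'S SHAPE on a model of
  `ρ̄` over an algebraically closed field — for an algebraically closed field `k` of characteristic
  `2` with the discrete topology, a ring map `ι : ℤ̄₂/𝔪 →+* k` and a continuous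
  `τ : Γ_ℚ → GL₂(k)` (`FramedGaloisRep ℚ k 2`) whose underlying homomorphism is `GL₂(ι) ∘ ρ̄`, the
  hypothesis is that `τ` ARISES FROM SOME NEWFORM: there are `N ≥ 1`, `w`, a newform
  `g ∈ S_w(Γ₁(N))` (`IsNewform1`) and `ι_g : 𝓞_g →+* k` (`coeffCharIntegers`) with `τ` unramified at
  every `q ∤ 2N` and `charpoly τ(Frob_q) = ι_g(X² - a_q(g) X + ε_g(q) q^{w-1})`
  (`IsGaloisRepOfNewform1Int g ι_g {q ∣ N·2} τ`) — VERBATIM the body of the in-tree weak form of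
  Serre's conjecture `exists_newform_of_odd_irreducible` (`SerreConjecture`) at `p = 2`, which the
  named fact `khare_wintenberger 2 k` proves for every continuous irreducible odd `τ`
  (`exists_newform_of_odd_irreducible_of_khare_wintenberger`, `SerreConjectureProofs`) — exactly the
  remark printed after Theorem 1.  Faithful, and if anything STRONGER than the printed hypothesis
  (so the fact is implied by the printed theorem): for irreducible `τ` equality of Frobenius
  characteristic polynomials at almost all `q` is `τ ≅ ρ̄_{g} ⊗ k` (Chebotarev and Brauer–Nesbitt,
  as recorded in the docstring of `SerreModularityConjecture`), i.e. "`ρ̄ ≅ ρ̄_g`" with no twist at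
  all, after enlarging `𝒪` so that its residue field contains the fields of definition (Tung's `𝒪`
  is "sufficiently large").  The field `k`, `ι` and `τ` occur only in this hypothesis, so the
  universal quantifier over them is the usual currying of "for SOME algebraically closed model".
* **Conclusion "`ρ` is modular"** ("isomorphic to a twist of `ρ_f` by a character"; Thm. 8.0.4:
  "(up to twist) `ρ` comes from a Hilbert modular form", proved in the form "`ρ|_{G_{F'}}` is
  automorphic", Def. 2.0.7): rendered EXACTLY as in `XZhang2024_fontaineMazurGL2_tateTwist` — some
  TATE twist `ρ ⊗ χ`, `χ(σ) = ε₂(σ)^m` with `m ∈ ℤ` (`cyclotomicPadicAlgCl ℚ 2`, the accepted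
  `ℚ̄₂`-valued cyclotomic character; `FramedRep.twist`), is attached to a newform
  `f ∈ S_w(Γ₁(N))` along an embedding `ι_f : K_f → ℚ̄₂` of its coefficient field away from `2N`
  (`IsGaloisRepOfNewform1 f ι_f {q ∣ N·2}`: unramified at `q ∤ 2N` with
  `charpoly (ρ ⊗ χ)(Frob_q) = ι_f(X² - a_q(f) X + ε_f(q) q^{w-1})`, arithmetic Frobenius — Deligne's
  normalisation, Deligne–Serre 1974 Thm. 6.1).  Why a Tate twist renders "a twist by a character":
  as in the module docstring of `FontaineMazurGL2OddPrimeTateTwist` — "`ρ` automorphic"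
  (`ρ ≅ r_ι(π)`, `π` regular algebraic cuspidal on `GL₂(𝔸_ℚ)`, the form Tung's proof establishes)
  is, over `ℚ`, `π = π_f ⊗ |det|^s` and `r_ι(π_f ⊗ |det|^s) = ρ_{f,ι_f} ⊗ ε₂^m`; equivalently, in the
  printed wording, the twisting character `θ` with `ρ ≅ ρ_f ⊗ θ` is unramified almost everywhere and
  de Rham at `2` (both `ρ` and `ρ_f` are), hence `θ = ε₂^{-m} θ₀` with `θ₀` of finite order, and
  `ρ_f ⊗ θ₀ = ρ_{f ⊗ θ₀}` for the newform `f ⊗ θ₀` (the normalisation every printed proof uses to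
  move the Hodge–Tate weights `{a, b}` to `{0, w-1}`: Kisin 2009, Introduction).

## What is NOT here (and why)

* Thm. 8.0.4 for `F ≠ ℚ` (totally real, `2` split completely): only the case `F = ℚ` (= Thm. 1) is
  vendored — `-- TODO(general form)` below; the automorphic rendering over `F` would be that of
  `Tung2021_hilbertTotallySplit`.
* Tung's local theorems (Thm. 2 = Thm. 8.0.2: the patched module meets every component of the
  potentially semistable deformation ring; Cor. 8.0.3: Breuil–Mézard for `GL₂(ℚ₂)`): no carrier in
  the tree (cf. `Literature.Barriers.Langlands.PatchingLocalComponentBarrierNarrow`).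
* The residually SOLVABLE dyadic cases — `ρ̄` reducible (open; Paškūnas–Tung 2021 §1.2) and `ρ̄`
  dihedral (Allen 2014 in the nearly ordinary case) — are the cruxes of route
  `Langlands/DyadicOddResidue`, not facts.
* Local–global compatibility at the ramified places and at `2` (only the a.e. unramified
  dictionary is rendered, as in the companions).
* No discharge: irreducibly XL (the `2`-adic patching of completed cohomology of Thm. 6.3.3/8.0.2 and
  the `p`-adic local Langlands correspondence for `GL₂(ℚ₂)`).

Consumer: route `Langlands/DyadicOddResidue`, crux `DyadicNonsolvableFM` (item stmt-Langlands-18744),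
derived from this fact and `khare_wintenberger 2 ·` in
`Summits/Langlands/Langlands/Theorems/DyadicOddResidueDyadicNonsolvableFM`.

## References

* S.-N. Tung, *On the modularity of 2-adic potentially semi-stable deformation rings*, Math. Z. 298
  (2021) 107–159, Thm. 1 (Introduction), Def. 2.0.7, Thm. 8.0.4 (numbering of arXiv:1908.06174).
  [Tung2020]
* C. Khare, J.-P. Wintenberger, Invent. Math. 178 (2009) 485–504, Thm. 1.2 and Thm. 9.1.
  [KhareWintenberger2009]
* M. Kisin, Invent. Math. 178 (2009) 587–634, Thm. 0.1, Cor. 0.2. [Kisin2009TwoAdic]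
* M. Kisin, J. Amer. Math. Soc. 22 (2009), Theorem of the Introduction (normalisation "twist of the
  Galois representation of a newform"). [Kisin2009]
* P. Deligne, J.-P. Serre, Ann. Sci. ÉNS 7 (1974), Thm. 6.1 (normalisation of `ρ_{f,λ}`).
  [DeligneSerreASENS1974]
* J.-P. Serre, Duke Math. J. 54 (1987), §3.2 (3.2.3)–(3.2.4) (the shape of (RM)). [Serre1987]
-/

noncomputable section

open scoped MatrixGroups Matrix NumberField ModularForm
open NumberField IsDedekindDomain Field Filter CongruenceSubgroup

namespace Literature.NumberTheory.Automorphic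

open Literature.NumberTheory.GaloisRepresentations
open Literature.NumberTheory.EllipticCurves.ModularForms

/-- **Tung 2020, Theorem 1 (= Theorem 8.0.4 for `F = ℚ`; with Khare–Wintenberger and Kisin for the
residual modularity it assumes): Fontaine–Mazur modularity for `GL₂` over `ℚ` at the prime `2` in
the regular case, for residual representations with NON-SOLVABLE image — rendering with a TATE
twist** (module docstring for the printed statements and the rendering, clause by clause).  Let
`ρ : Γ_ℚ → GL₂(ℚ̄₂)` be continuous, unramified at all but finitely many places, irreducible and odd,
de Rham at `2` (Fontaine's pinned datum `fontainePstAdicCompletion`) with distinct labelled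
Hodge–Tate weights, whose residual representation `ρ̄ = ρ.residualRep : Γ_ℚ → GL₂(ℤ̄₂/𝔪)` has
non-solvable image and is modular in Serre's sense on some model over an algebraically closed
field `k` of characteristic `2` (a continuous `τ : Γ_ℚ → GL₂(k)` with underlying homomorphism
`GL₂(ι) ∘ ρ̄`, `ι : ℤ̄₂/𝔪 →+* k`, arising from some newform `g`: unramified at `q ∤ 2N` with
`charpoly τ(Frob_q) = ι_g(X² - a_q(g) X + ε_g(q) q^{w-1})`, the body of
`exists_newform_of_odd_irreducible` at `p = 2`).  Then `ρ` is modular: some Tate twist `ρ ⊗ χ`,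
`χ(σ) = ε₂(σ)^m` (`m ∈ ℤ`, `ε₂ = cyclotomicPadicAlgCl ℚ 2`), is attached to a newform
`f ∈ S_w(Γ₁(N))` along an embedding `ι_f : K_f → ℚ̄₂` away from `2N` — unramified at every prime
`q ∤ 2N` with `charpoly (ρ ⊗ χ)(Frob_q) = ι_f(X² - a_q(f) X + ε_f(q) q^{w-1})` (arithmetic
Frobenius).  VERBATIM `XZhang2024_fontaineMazurGL2_tateTwist` at the prime `2` with the clauses
(NS) and (RM) added.  Named fact (D-0014); users take `(h : Tung2020_fontaineMazurGL2_two_tateTwist)`.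
[cite: Tung2020, Thm. 1 (Introduction) and Thm. 8.0.4 with Def. 2.0.7 (numbering of arXiv:1908.06174)]
[cite: KhareWintenberger2009, Thm. 1.2 and Thm. 9.1 (residual modularity over ℚ, as remarked after Thm. 1)]
[cite: Kisin2009TwoAdic, Thm. 0.1, Cor. 0.2] [cite: DeligneSerreASENS1974, Thm. 6.1] -/
def Tung2020_fontaineMazurGL2_two_tateTwist : Prop :=
  -- TODO(general form): Thm. 8.0.4 is stated for every totally real `F` in which `2` splits
  -- completely ("(up to twist) `ρ` comes from a Hilbert modular form"); only `F = ℚ` (Thm. 1) here.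
  ∀ (ρ : FramedGaloisRep ℚ (PadicAlgCl 2) 2),
    (∀ᶠ v : HeightOneSpectrum (𝓞 ℚ) in cofinite, ρ.IsUnramifiedAt v) →
    ρ.toGaloisRep.IsIrreducible → ρ.IsOdd →
    (∀ (v : HeightOneSpectrum (𝓞 ℚ)) (hv : ((2 : ℕ) : 𝓞 ℚ) ∈ v.asIdeal),
      (PAdicHodge.fontainePstAdicCompletion v 2 hv).IsDeRhamFramed (ρ.toLocal v) ∧
      ∀ τ : v.adicCompletion ℚ →+* PadicAlgCl 2, Continuous τ →
        (ρ.labelledHodgeTateWeightsAt v (PAdicHodge.fontainePstAdicCompletion v 2 hv).algebra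
          (PAdicHodge.fontainePstAdicCompletion v 2 hv).𝔅 τ).Nodup) →
    ¬ IsSolvable ρ.residualRep.range →
    ∀ (k : Type) [Field k] [TopologicalSpace k] [DiscreteTopology k] [CharP k 2] [IsAlgClosed k]
      (ι : padicAlgClResidueField 2 →+* k) (τ : FramedGaloisRep ℚ k 2),
      (τ : absoluteGaloisGroup ℚ →* GL (Fin 2) k) =
        (Matrix.GeneralLinearGroup.map ι).comp ρ.residualRep →
      (∃ (N : ℕ) (_ : NeZero N) (w : ℕ) (g : CuspForm (Gamma1 N) (w : ℤ))
          (ιg : coeffCharIntegers g →+* k),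
          IsNewform1 g ∧ IsGaloisRepOfNewform1Int g ιg {q | q ∣ N * 2} τ) →
      ∃ (χ : absoluteGaloisGroup ℚ →ₜ* (PadicAlgCl 2)ˣ) (m : ℤ),
        (∀ σ, χ σ = cyclotomicPadicAlgCl ℚ 2 σ ^ m) ∧
        ∃ (N : ℕ) (_ : NeZero N) (w : ℤ) (f : CuspForm (Gamma1 N) w)
          (ιf : coeffCharField f →+* PadicAlgCl 2),
          IsNewform1 f ∧ IsGaloisRepOfNewform1 f ιf {q | q ∣ N * 2} (FramedRep.twist ρ χ)

end Literature.NumberTheory.Automorphic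

end
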